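import Summits.BirchSwinnertonDyer.Rank1Residual.GaloisImage.EPCPrimeTorsion
import Summits.BirchSwinnertonDyer.Rank1Residual.GaloisImage.EPCReductionToPrimeTorsion
import Literature.NumberTheory.GaloisRepresentations.LocalEulerPoincareCharacteristic
import HarnessLib

/-!
# Tate's local Euler–Poincaré characteristic formula: discharge of the named fact
# (cell `b2b-bsdres`, team n1011, row T-EPC = Tate's local Euler–Poincaré characteristic; seat p04 GEN 8; stage D7)

HONEST FRAMING (cell `b2b-bsdres`, run/shared/lean/b2b/bsd-rank1-residual/, verbatim in every
file): the goal of the cell is to DELETE the COMBINATION-SHAPED residual classes of the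
Birch–Swinnerton-Dyer formula for ALL analytic-rank `≤ 1` elliptic curves over `ℚ` — "full BSD
formula for every rank `≤ 1` curve in class `C`" assembled STRICTLY from published theorems — so
that the rank-`≤ 1` remainder becomes exactly the CONSTRUCTION-SHAPED classes, which are TYPED
(missing-input `Prop`s), NOT attempted. This is not "finishing BSD". Team n1011 (N10 / N11, the
additive block X4 ∧ `p = 3`): research route; no claim beyond the stated classes; nothing is
booked; no mark / label is changed by this file. Theorems only (no definition, no named fact, no
`sorry`).  (Placement: Summits/GaloisImage with the T-EPC cone; the discharge theorem carries the
`_root_.Literature…` name of the fact per the n1011 lead's rulings R5-64/65/66.)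

## What

**Tate's local Euler–Poincaré characteristic formula** (Milne, *ADT* I Thm. 2.8; Serre, *CG* II
§5.7 Thm. 5; Tate 1962): for a non-archimedean local field `F` of characteristic `0` and every
finite discrete `Γ_F`-module `M`, `H¹(F, M)` and `H²(F, M)` are finite and
`#H⁰(F, M) · #H²(F, M) · #(𝒪_F / #M 𝒪_F) = #H¹(F, M)`, i.e. `χ(F, M) = (𝒪_F : #M 𝒪_F)^{-1}`.
This proves the tree's named fact `Literature.NumberTheory.GaloisRepresentations.localEulerPoincareCharacteristic F`
(`def … : Prop`, file `Literature/NumberTheory/GaloisRepresentations/LocalEulerPoincareCharacteristic.lean`)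
— the statement is used verbatim, nothing is restated.  Assembly: reduction to modules killed by one
prime `ℓ` (stage D2 `EPCMul.localEPC_of_forall_prime`); `ℓ ≠ p` is the tree's
`localEulerPoincareCharacteristic_of_isPrimaryTorsion_of_ne`; `ℓ = p` the residue characteristic is
stage D6 `EPCPrime.localEPC` (wild dévissage, tame chain, cyclic descent, and the tame layer of
stage C5 built on the equivariant Kummer theory and Milne's Lemma 2.11 of stages B–C).

References: J. S. Milne, *Arithmetic Duality Theorems* (2006), I §2 Thm. 2.8 [MilneADT2006];
J.-P. Serre, *Galois Cohomology* (1997), II §5.7 Thm. 5 [SerreGaloisCohomology1997];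
J. Tate, *Duality theorems in Galois cohomology over number fields*, ICM 1962 [Tate1962ICM].
-/

noncomputable section

open CategoryTheory Function Field
open scoped ValuativeRel
open Literature.NumberTheory.GaloisRepresentations

universe u

namespace Summit.BirchSwinnertonDyer.Rank1Residual.GaloisImage

/-- **Tate's local Euler–Poincaré characteristic formula** — the named fact
`localEulerPoincareCharacteristic F` holds for every non-archimedean local field `F` of
characteristic `0`: for every finite discrete `Γ_F`-module `M`, `H¹(F, M)`, `H²(F, M)` are finite
and `#H⁰(F,M) · #H²(F,M) · #(𝒪_F/#M) = #H¹(F,M)`. [cite: MilneADT2006, I §2 Thm 2.8 (p. 31)]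
[cite: SerreGaloisCohomology1997, II §5.7 Thm. 5] -/
theorem _root_.Literature.NumberTheory.GaloisRepresentations.localEulerPoincareCharacteristic_holds
    (F : Type u) [Field F] [ValuativeRel F] [TopologicalSpace F] [IsNonarchimedeanLocalField F]
    [CharZero F] : localEulerPoincareCharacteristic F := by
  intro M _ _ _ _ ρ
  refine EPCMul.localEPC_of_forall_prime F (fun ℓ _ A _ _ _ _ τ hℓ => ?_) ρ
  by_cases h : ℓ = ringChar 𝓀[F]
  · subst h
    exact EPCPrime.localEPC F τ hℓ
  · exact localEulerPoincareCharacteristic_of_isPrimaryTorsion_of_ne F τ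
      (fun a => ⟨1, by rw [pow_one]; exact hℓ a⟩) h

/-- Tate's formula, unfolded form (same content as the named fact, for direct use).
[cite: MilneADT2006, I §2 Thm 2.8 (p. 31)] -/
theorem localEulerPoincare (F : Type u) [Field F] [ValuativeRel F] [TopologicalSpace F]
    [IsNonarchimedeanLocalField F] [CharZero F]
    {M : Type u} [AddCommGroup M] [TopologicalSpace M] [DiscreteTopology M] [Finite M]
    (ρ : ContinuousRep (absoluteGaloisGroup F) ℤ M) :
    Finite (continuousCohomology 1 ρ.toTopRep) ∧ Finite (continuousCohomology 2 ρ.toTopRep) ∧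
      Nat.card ρ.toTopRep.ρ.invariants * Nat.card (continuousCohomology 2 ρ.toTopRep) *
          Nat.card (𝒪[F] ⧸ Ideal.span {((Nat.card M : ℕ) : 𝒪[F])}) =
        Nat.card (continuousCohomology 1 ρ.toTopRep) :=
  Literature.NumberTheory.GaloisRepresentations.localEulerPoincareCharacteristic_holds F ρ

end Summit.BirchSwinnertonDyer.Rank1Residual.GaloisImage

end
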